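import Summits.QuantumFields.YangMills.Theorems.AlphaInputsT3ACv3Reg68LevelsOfFineRegular
import Summits.QuantumFields.YangMills.Theorems.AlphaInputsT3ACv3LocalSmallXOfLevels
import Summits.QuantumFields.YangMills.Theorems.AlphaInputsT3ACv3RegionalThm1Carrier
import HarnessLib

/-!
# `AlphaInputsT3ACv3ConstraintConeSmall` — B1 EDGES-A v2, FILE 1 row (n1): NESTED FINE REGULARITY (2) ⇒ SMALL (0.4)-LOOPS ON THE CONSTRAINT'S READ CONE —
# the core-membership lemma that makes the closed core of ✓ `AlphaInputsT3AC.isClosed_coneFibreRegLe` (the class `C` of the measurable-argmin theorem for B1)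
# CONSISTENT with the display ✓ `AlphaInputsT3AC.NestedRegularSelT3R7`'s clause (2)

Cell `ym3-torus` (HUMAN RULING D-0037; YM ladder rung R3 = finite-torus SU(2) YM₃, NOT the Clay problem), width seat `ym-ust-19936-w2` (gen 6) on
stmt-QuantumFields-19936 `HistoryTailL`; LEAD ★w1-19936 g4 word 2026-08-28T11:55:21Z «(n1) GO».  `--supports stmt-QuantumFields-19936 --as helper`; def-free; count-neutral.

WHY.  The measurable argmin of B1 (✓ `exists_measurable_argmin_closedClass` over the closed set of ✓ `…Data7Closed.isClosed_coneFibreRegLe`) lives on the LOCAL small-loop core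
`LocalSmallLoop.NestedSmallOn ℰp (δ∕2) (constraintCone k h) k` — small (0.4)-loop variables of the `s`-fold averages at the bonds of the exact dependency cone of the bonds the
multi-level constraint (3) reads (`RegionalVP.bondsOn i (Λ_i(h))`, one end-point in `Λ_i(h)` — print's convention, [Balaban1985Variational] (1) p.277).  For print's pinned
minimiser to be a candidate of that argmin, the display's NESTED REGULARITY (2) — every fine plaquette cornered in `Ω_i(h)` within `α_i·L^{−2i}` of `1` ([Balaban1985UV3] p.267
l.1–3, (68) p.273) — must put it in the core.  THIS FILE proves exactly that, with the SAME hypothesis list as ★w4 g4's r-68b ✓ `Reg68LevelsOfFineRegular.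
mem_reg68LevelsSet_of_plaqSmallOn_Omega` (minus its level-0 window `hwin0`: cone bonds sit at levels `s+1 ≤ i`, so `i ≥ 1`), so that NODE O ∕ EDGES-B discharge both rows
from one regularity input and the record windows (w) of the display.
HOW.  A cone bond `c′` of `T^{(s+1)}` carries a witness `(i, c)`: `s+1 ≤ i ≤ k`, `c` a bond of `T^{(i)}` ON `Λ_i(h)`, and the `i`-blocks of `c′`'s end-points among `{c₋, c₊}`.
✓ `BoxStokes.dist1_loopHol_le_twoBlock` reduces the (0.4) loop at `c′` to the level-`s` TWO-BLOCK plaquettes `q`; for each, the base point `toFine s q₋` is at scale-`i` distance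
`≤ 1` from `c`'s end-point `w ∈ Λ_i(h) ⊆ Ω_i(h)`, hence at fine distance `≤ 4·Lⁱ` (`sdist_zero_add_le`, the iterated expansion ✓ `Run3Collar.sdist_le_succ`); so the hull of
radius `(7L+2)·Σ_{t<s}Lᵗ` of ✓ `N21LocalAveragedRegularity.plaqSmallOn_iter_blockAvg_eml_loc_level` around it lies in `Ω_{i−1}(h)` by ✓ `mem_Omega_pred_of_tdist_le` under the
collar `42L + 18 ≤ 6M₁ ≤ Rcol(i−1)` (✓ `six_mul_M₁_le_rcolOf`, `7L+3 ≤ M₁`; budget `(71L+34)·L^{i−1} < (84L+38)·L^{i−1}` — r-68b's `63L+34 < 64L+38` plus the one-block offset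
`8L·L^{i−1}`), where (2) at level `i−1` feeds Prop. 2: `|((ℰp-avg)ˢU)(∂q) − 1| < 2L²α_{i−1}·L^{−2(i−s)} ≤ C68·θ(K−i)·L^{−2(i−s)}` (window `hwin`), and ✓ `loopWindow_T3` closes
`(25L²∕4)·θ·L^{−2(i−s)} ≤ (25∕4)·θ ≤ δ∕2`.
WHAT.  §1 `sdist_zero_add_le` (iterated scale expansion, generic `Params`); §2 ★ `AlphaInputsT3AC.dist1_plaqHol_iter_le_near_Omega` — the r-68b engine for a level-`s` plaquette
whose base point is at scale-`i` distance `≤ 1` from a point of `Ω_i(h)` (`1 ≤ i`, `s + 1 ≤ i ≤ k`): `|((ℰp-avg)ˢU)(∂q) − 1| ≤ C68·θ(K−i)·L^{−2(i−s)}`; §3 ★★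
`AlphaInputsT3AC.mem_nestedSmallOn_constraintCone_of_plaqSmallOn_Omega` (the cone written inline, byte-identical with ✓ `…Data7Closed.depClosed₂_constraintCone`'s family).
HONEST FRAMING.  Geometry + the tree's local Prop. 2; no new estimate of [Balaban1985UV3]∕[Balaban1985Variational] is asserted; B1, EDGES-B, NODE O, the stub
`AlphaInputsT3ACv4RecChi`, the crux `HistoryTailL` are NOT claimed.  YM₃ on the three-torus is rung R3 of the programme, NOT the Clay problem: nothing here bears on d = 4,
infinite volume, or a mass gap.

References: T. Bałaban, Commun. Math. Phys. 102 (1985) 255–275 [Balaban1985UV3] ((39)–(42) p.266, p.267 l.1–3, (68) p.273); Commun. Math. Phys. 102 (1985) 277–309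
[Balaban1985Variational] ((1) p.277, (2)–(3) p.278); Commun. Math. Phys. 98 (1985) 17–51 [Balaban1985Averaging] (Prop. 2 (52)–(54) p.26, (19)–(20) p.21); Commun. Math. Phys. 109
(1987) 249–301 [Balaban1987RG1] ((0.4) p.253).
-/

set_option autoImplicit false

noncomputable section

open scoped BigOperators

namespace Summit.QuantumFields.YangMills.Theorems

open Set
open scoped Matrix.Norms.L2Operator
open Literature.MathematicalPhysics.QuantumFieldTheory.Balaban1983to89
open Literature.MathematicalPhysics.QuantumFieldTheory.Balaban1983to89.ExpMeanLog (deltaSU expMeanLogSU)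
open Literature.MathematicalPhysics.QuantumFieldTheory.Balaban1983to89.T3ContinuumYM3Torus
open Literature.MathematicalPhysics.QuantumFieldTheory.Balaban1983to89.T3UnitLawDensityEML (ℰp)
open Literature.MathematicalPhysics.QuantumFieldTheory.Balaban1983to89.T3UnitScaleTilt (θBal)
open Literature.MathematicalPhysics.QuantumFieldTheory.Balaban1983to89.T3MinimiserStabilityReduction (θBal_pos)
open Literature.MathematicalPhysics.QuantumFieldTheory.Balaban1983to89.B10Eq38TorusDomains (toFine toFine_zero toFine_succ cornerSet plaqsIn mem_plaqsIn_iff)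
open Literature.MathematicalPhysics.QuantumFieldTheory.Balaban1983to89.B10Eq42TorusConstraint (lam42)
open Literature.MathematicalPhysics.QuantumFieldTheory.Balaban1983to89.B3Taylor310LocalRemainder (tdist_comm tdist_triangle tdist_self)
open Literature.MathematicalPhysics.QuantumFieldTheory.Balaban1985CMP102.Setting
open Summit.QuantumFields.Balaban3D.Carriers
open Summit.QuantumFields.Balaban3D.Proofs.Primitives (AlphaConsts)
open Summit.QuantumFields.Balaban3D.Proofs.Run3Collar (sdist_le_succ tdist_shift_le)
open Summit.QuantumFields.YangMills.BalabanUVNodes.N20LCSAvgDominationRegion (boxRegion mem_boxRegion)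
open Summit.QuantumFields.YangMills.Theorems.N21LocalAveragedRegularity (exists_embChain plaqSmallOn_iter_blockAvg_eml_loc_level)
open Summit.QuantumFields.YangMills.Theorems.Reg68LevelsOfFineRegular
  (radii_step two_mul_sum_pow_le sum_pow_le_sum_pow_of_le toFine_chain tdist_corner_le_of_mem_boxRegion sdist_zero mem_Omega_pred_of_tdist_le lam42_subset_Omega
    three_le_L six_mul_M₁_le_rcolOf)
open Summit.QuantumFields.YangMills.Theorems.LocalSmallLoop (NestedSmallOn)
open Summit.QuantumFields.YangMills.Theorems.RegionalVP (bondsOn)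

/-! ## §1 Iterated scale expansion -/

section Geometry

variable {P : Params}

/-- **SCALE EXPANSION, ITERATED**: `sdist 0 x y + d ≤ Lʲ·sdist j x y + d·Lʲ` (`j` in the standing range; from ✓ `Run3Collar.sdist_le_succ` `sdist j ≤ L·sdist (j+1) + d(L − 1)`), i.e.
two fine sites whose scale-`j` blocks are at distance `n` are at fine distance `≤ Lʲ·n + d·(Lʲ − 1)`. [folklore] -/
theorem sdist_zero_add_le (x y : Site P 0) : ∀ j : ℕ, j ≤ P.m + P.K → sdist 0 x y + P.d ≤ P.L ^ j * sdist j x y + P.d * P.L ^ j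
  | 0, _ => by simp
  | j + 1, hj => by
    have ih := sdist_zero_add_le x y j (by omega)
    have hstep := sdist_le_succ (P := P) hj x y
    have hL : 1 ≤ P.L := by have := P.hL.2; omega
    have h1 : P.L ^ j * sdist j x y ≤ P.L ^ (j + 1) * sdist (j + 1) x y + P.d * P.L ^ j * (P.L - 1) :=
      calc P.L ^ j * sdist j x y ≤ P.L ^ j * (P.L * sdist (j + 1) x y + P.d * (P.L - 1)) := Nat.mul_le_mul_left _ hstep
        _ = P.L ^ (j + 1) * sdist (j + 1) x y + P.d * P.L ^ j * (P.L - 1) := by rw [pow_succ]; ring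
    have h2 : P.d * P.L ^ j * (P.L - 1) + P.d * P.L ^ j = P.d * P.L ^ (j + 1) := by
      calc P.d * P.L ^ j * (P.L - 1) + P.d * P.L ^ j = P.d * P.L ^ j * (P.L - 1 + 1) := by ring
        _ = P.d * P.L ^ (j + 1) := by rw [Nat.sub_add_cancel hL, pow_succ]; ring
    calc sdist 0 x y + P.d ≤ P.L ^ j * sdist j x y + P.d * P.L ^ j := ih
      _ ≤ P.L ^ (j + 1) * sdist (j + 1) x y + P.d * P.L ^ j * (P.L - 1) + P.d * P.L ^ j := Nat.add_le_add_right h1 _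
      _ = P.L ^ (j + 1) * sdist (j + 1) x y + P.d * P.L ^ (j + 1) := by rw [add_assoc, h2]

/-- **ONE BLOCK AWAY IS `(d+1)·Lʲ` AWAY**: two fine sites whose scale-`j` blocks are equal or adjacent (`sdist j x y ≤ 1`) are at fine `ℓ¹`-distance `≤ (d+1)·Lʲ`. [folklore] -/
theorem tdist_le_of_sdist_le_one {x y : Site P 0} {j : ℕ} (hj : j ≤ P.m + P.K) (h : sdist j x y ≤ 1) : Site.tdist x y ≤ (P.d + 1) * P.L ^ j := by
  have h0 := sdist_zero_add_le x y j hj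
  rw [sdist_zero] at h0
  have h1 : P.L ^ j * sdist j x y ≤ P.L ^ j := by simpa using Nat.mul_le_mul_left (P.L ^ j) h
  have : Site.tdist x y + P.d ≤ P.L ^ j + P.d * P.L ^ j := h0.trans (Nat.add_le_add_right h1 _)
  calc Site.tdist x y ≤ P.L ^ j + P.d * P.L ^ j := by omega
    _ = (P.d + 1) * P.L ^ j := by ring

end Geometry

/-! ## §2 The r-68b engine one block off `Ω_i(h)`: averaged plaquettes near a point of `Ω_i(h)` -/

section T3

variable {F : T3Family} {𝔠 : AlphaConsts F.L (suGroupModel 2).N} {γ : ℝ} {hγ : 0 < γ} {hγ1 : γ ≤ (min 𝔠.gamma0 1) ^ 2} {K : ℕ}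

/-- ★ **AVERAGED PLAQUETTES ONE BLOCK OFF `Ω_i(h)` ARE (68)-SMALL** (the r-68b engine of ✓ `mem_reg68LevelsSet_of_plaqSmallOn_Omega_of_collar`, `i ≥ 1` branch, with the base point
allowed at scale-`i` distance `≤ 1` from a point `y ∈ Ω_i(h)` instead of IN `Ω_i(h)`): for `s + 1 ≤ i ≤ k ≤ K`, a level-`s` plaquette `q` with `sdist i (toFine s q₋) y ≤ 1`, and a fine
configuration `U` with NESTED fine regularity `α_j·L^{−2j}` on the `Ω_j(h)` (`j ≤ k`), Prop. 2's smallness one factor `L²` up, the record size `7L + 3 ≤ M₁` and the window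
`2L²·α_{i−1} ≤ C68·θBal(K−i)`: `|((ℰp-avg)ˢU)(∂q) − 1| ≤ C68·θBal(K−i)·L^{−2(i−s)}` — the hull of radius `(7L+2)Σ_{t<s}Lᵗ` around `toFine s q₋` lies in `Ω_{i−1}(h)` (collar
`42L+18 ≤ Rcol(i−1)`, budget `(71L+34)·L^{i−1} < (84L+38)·L^{i−1}`), where (2) at level `i−1` feeds ✓ `plaqSmallOn_iter_blockAvg_eml_loc_level`.
[cite: Balaban1985UV3, (39) p.266, p.267 l.1–3, (68) p.273; Balaban1985Averaging, Prop. 2 (52)–(54) p.26] -/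
theorem AlphaInputsT3AC.dist1_plaqHol_iter_le_near_Omega {k : ℕ} (hk : k ≤ K) (h : Hist (F.P K) k)
    {U : GaugeField (F.P K) 0 (Matrix.specialUnitaryGroup (Fin 2) ℂ)} {α : ℕ → ℝ} (hα : ∀ i, i ≤ k → 0 < α i)
    (hU : ∀ i, i ≤ k → PlaqSmallOn (↑(plaqsIn 0 (Omega 𝔠.lane.carrier.M₁
        (rcolOf (T3Scales F γ hγ (hγ1.trans (sq_min_one_le _ 𝔠.gamma0_pos)) K) 𝔠.lane.carrier) k h i)) : Set (Plaq (F.P K) 0))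
        (α i * (((F.L : ℝ) ^ i)⁻¹) ^ 2) U)
    (hsmall : ∀ i, i ≤ k → (143 * ((7 : ℝ) ^ 2 / 4) ^ 2) * ((F.L : ℝ) ^ 2 * α i) ≤ 1 / 3 ∧
        2 * ((F.L : ℝ) ^ 2 * α i) ≤ 2 * deltaSU (Fin 2) / ((7 * F.L : ℕ) : ℝ) ^ 2)
    (hM₁ : 7 * F.L + 3 ≤ 𝔠.M₁)
    (hwin : ∀ i, 1 ≤ i → i ≤ k → 2 * ((F.L : ℝ) ^ 2 * α (i - 1)) ≤ 𝔠.C68 * θBal F.L γ 𝔠.b₀ 𝔠.p₀ (K - i))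
    {s i : ℕ} (hsi : s + 1 ≤ i) (hik : i ≤ k) (q : Plaq (F.P K) s) {y : Site (F.P K) 0}
    (hy : y ∈ Omega 𝔠.lane.carrier.M₁ (rcolOf (T3Scales F γ hγ (hγ1.trans (sq_min_one_le _ 𝔠.gamma0_pos)) K) 𝔠.lane.carrier) k h i)
    (hnear : sdist i (toFine s q.src) y ≤ 1) :
    GaugeGroup.dist1 (GaugeField.plaqHol (Averaging.iter (fun l => BlockAveraging.blockAvg (P := F.P K) (j := l) ℰp) s U) q) ≤
      𝔠.C68 * θBal F.L γ 𝔠.b₀ 𝔠.p₀ (K - i) * ((((F.L : ℝ) ^ (i - s))⁻¹) ^ 2) := by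
  set S := T3Scales F γ hγ (hγ1.trans (sq_min_one_le _ 𝔠.gamma0_pos)) K with hS
  set Ω : ℕ → Set (Site (F.P K) 0) := Omega 𝔠.lane.carrier.M₁ (rcolOf S 𝔠.lane.carrier) k h with hΩ
  have hL3 : 3 ≤ F.L := three_le_L F
  have hLpos : (0 : ℝ) < (F.L : ℝ) := by exact_mod_cast (show 0 < F.L by omega)
  have hi1 : 1 ≤ i := by omega
  have hsi' : s ≤ i := by omega
  have hPL : (F.P K).L = F.L := rfl
  have hPd : (F.P K).d = 3 := rfl
  have hiK : i ≤ (F.P K).m + (F.P K).K := hik.trans (AlphaInputsT3AC.le_standing_of_le hk)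
  have him : i - 1 ≤ (F.P K).m + (F.P K).K := by omega
  -- the chain of block centres below `q₋`
  obtain ⟨xs, hxs_top, hxs⟩ := exists_embChain (P := F.P K) s q.src
  have hy0 : toFine s q.src = xs 0 := by rw [← hxs_top]; exact toFine_chain xs hxs s le_rfl
  -- the base point is within `4·Lⁱ` of `y ∈ Ω_i(h)`
  have hnear' : Site.tdist (xs 0) y ≤ 4 * F.L ^ i := by
    have hsd : sdist i (xs 0) y ≤ 1 := by rw [← hy0]; exact hnear
    have := tdist_le_of_sdist_le_one (P := F.P K) hiK hsd
    rw [hPd, hPL] at this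
    exact this
  -- the radii of the hull
  set c : ℕ := ((F.P K).d + 4) * (F.P K).L + 2 with hc
  set r : ℕ → ℕ := fun j => c * ∑ t ∈ Finset.range (s - j), (F.P K).L ^ t with hr
  have hrstep : ∀ j < s, (F.P K).L * r (j + 1) + (((F.P K).d + 4) * (F.P K).L + 2) ≤ r j := fun j hj => by
    rw [hr]; exact (radii_step c s hj).le
  have hr0 : r 0 = c * ∑ t ∈ Finset.range s, F.L ^ t := by rw [hr]; simp
  have hsum : 2 * ∑ t ∈ Finset.range s, F.L ^ t ≤ 3 * F.L ^ (i - 1) := by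
    have h1 : ∑ t ∈ Finset.range s, F.L ^ t ≤ ∑ t ∈ Finset.range (i - 1 + 1), F.L ^ t :=
      sum_pow_le_sum_pow_of_le F.L (by omega)
    exact (Nat.mul_le_mul_left 2 h1).trans (two_mul_sum_pow_le hL3 (i - 1))
  -- the TRUE collar: `42L + 18 ≤ 6M₁ ≤ Rcol(i−1)`
  have hcol : 42 * F.L + 18 ≤ rcolOf S 𝔠.lane.carrier (i - 1) :=
    calc 42 * F.L + 18 ≤ 6 * (7 * F.L + 3) := by omega
      _ ≤ 6 * 𝔠.M₁ := Nat.mul_le_mul_left _ hM₁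
      _ ≤ _ := six_mul_M₁_le_rcolOf F 𝔠 γ hγ hγ1 K (i - 1) (by omega)
  -- the hull lies in `Ω_{i−1}(h)`
  have hhull : ∀ p ∈ boxRegion (xs 0) (r 0), p ∈ plaqsIn 0 (Ω (i - 1)) := by
    intro p hp
    refine mem_plaqsIn_iff.mpr fun z hz => ?_
    refine mem_Omega_pred_of_tdist_le 𝔠.lane.carrier.M₁ (rcolOf S 𝔠.lane.carrier) h hi1 hik him hy
      ((tdist_triangle z (xs 0) y).trans (Nat.add_le_add (tdist_corner_le_of_mem_boxRegion hp hz) hnear')) ?_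
    -- `3·r(0) + 2 + 4Lⁱ + 6·L^{i−1} < L^{i−1}·(Rcol(i−1) + 1)` from the collar
    rw [hPd, hPL, hr0]
    have hc' : c = 7 * F.L + 2 := by rw [hc, hPd, hPL]
    rw [hc']
    have hLi : 1 ≤ F.L ^ (i - 1) := Nat.one_le_pow _ _ (by omega)
    set Pw : ℕ := F.L ^ (i - 1) with hPw
    have hLiPw : F.L ^ i = F.L * Pw := by
      rw [hPw, ← pow_succ', Nat.sub_add_cancel hi1]
    rw [hLiPw]
    set Sg : ℕ := ∑ t ∈ Finset.range s, F.L ^ t with hSg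
    have key : 2 * (3 * ((7 * F.L + 2) * Sg) + 2 + 4 * (F.L * Pw) + 2 * 3 * Pw) ≤ (71 * F.L + 34) * Pw :=
      calc 2 * (3 * ((7 * F.L + 2) * Sg) + 2 + 4 * (F.L * Pw) + 2 * 3 * Pw)
            = 3 * (7 * F.L + 2) * (2 * Sg) + 4 + 8 * F.L * Pw + 12 * Pw := by ring
        _ ≤ 3 * (7 * F.L + 2) * (3 * Pw) + 4 * Pw + 8 * F.L * Pw + 12 * Pw :=
            Nat.add_le_add_right (Nat.add_le_add_right (Nat.add_le_add (Nat.mul_le_mul_left _ hsum) (by omega)) _) _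
        _ = (71 * F.L + 34) * Pw := by ring
    have key2 : (71 * F.L + 34) * Pw < 2 * (Pw * (rcolOf S 𝔠.lane.carrier (i - 1) + 1)) :=
      calc (71 * F.L + 34) * Pw < (84 * F.L + 38) * Pw := Nat.mul_lt_mul_of_pos_right (by omega) (by omega)
        _ = 2 * (Pw * ((42 * F.L + 18) + 1)) := by ring
        _ ≤ 2 * (Pw * (rcolOf S 𝔠.lane.carrier (i - 1) + 1)) :=
            Nat.mul_le_mul_left _ (Nat.mul_le_mul_left _ (Nat.add_le_add_right hcol _))
    exact Nat.lt_of_mul_lt_mul_left (lt_of_le_of_lt key key2)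
  -- the fine hypothesis on the hull, in Prop. 2's currency `α₀·(Lˢ)⁻²`
  set a : ℝ := α (i - 1) with ha
  have hapos : 0 < a := hα (i - 1) (by omega)
  set α₀ : ℝ := a * ((F.L : ℝ) ^ s * ((F.L : ℝ) ^ (i - 1))⁻¹) ^ 2 with hα₀
  have hLs : (0 : ℝ) < (F.L : ℝ) ^ s := by positivity
  have hLi1 : (0 : ℝ) < (F.L : ℝ) ^ (i - 1) := by positivity
  have hα₀pos : 0 < α₀ := by positivity
  have hα₀_eq : α₀ * (((F.L : ℝ) ^ s)⁻¹) ^ 2 = a * (((F.L : ℝ) ^ (i - 1))⁻¹) ^ 2 := by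
    rw [hα₀]; field_simp
  -- `α₀ ≤ L²·a` since `s ≤ i`
  have hratio : (F.L : ℝ) ^ s * ((F.L : ℝ) ^ (i - 1))⁻¹ ≤ (F.L : ℝ) := by
    rw [mul_inv_le_iff₀ hLi1, ← pow_succ']
    exact pow_le_pow_right₀ (by exact_mod_cast (show 1 ≤ F.L by omega)) (by omega)
  have hratio0 : 0 ≤ (F.L : ℝ) ^ s * ((F.L : ℝ) ^ (i - 1))⁻¹ := by positivity
  have hα₀le : α₀ ≤ (F.L : ℝ) ^ 2 * a := by
    rw [hα₀]
    have : ((F.L : ℝ) ^ s * ((F.L : ℝ) ^ (i - 1))⁻¹) ^ 2 ≤ (F.L : ℝ) ^ 2 := by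
      rw [sq, sq]; exact mul_le_mul hratio hratio hratio0 hLpos.le
    calc a * ((F.L : ℝ) ^ s * ((F.L : ℝ) ^ (i - 1))⁻¹) ^ 2 ≤ a * (F.L : ℝ) ^ 2 := mul_le_mul_of_nonneg_left this hapos.le
      _ = (F.L : ℝ) ^ 2 * a := mul_comm _ _
  obtain ⟨hs3, hs2⟩ := hsmall (i - 1) (by omega)
  have hα3 : (143 * (((((F.P K).d + 4 : ℕ) : ℝ)) ^ 2 / 4) ^ 2) * α₀ ≤ 1 / 3 := by
    have e : ((((F.P K).d + 4 : ℕ) : ℝ)) = 7 := by rw [hPd]; norm_num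
    rw [e]
    have h0 : 0 ≤ 143 * ((7 : ℝ) ^ 2 / 4) ^ 2 := by positivity
    exact (mul_le_mul_of_nonneg_left hα₀le h0).trans hs3
  have hα2 : 2 * α₀ ≤ 2 * deltaSU (Fin 2) / ((((F.P K).d + 4) * (F.P K).L : ℕ) : ℝ) ^ 2 := by
    have e : ((((F.P K).d + 4) * (F.P K).L : ℕ) : ℝ) = ((7 * F.L : ℕ) : ℝ) := by rw [hPd, hPL]
    rw [e]
    exact le_trans (by linarith [hα₀le]) hs2
  have h52 : PlaqSmallOn (↑(boxRegion (xs 0) (r 0)) : Set (Plaq (F.P K) 0)) (α₀ * ((((F.P K).L : ℝ) ^ s)⁻¹) ^ 2) U := by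
    intro p hp
    have hp' : p ∈ plaqsIn 0 (Ω (i - 1)) := hhull p (Finset.mem_coe.mp hp)
    have hlt := hU (i - 1) (by omega) p (Finset.mem_coe.mpr hp')
    rw [hPL, hα₀_eq]
    exact hlt
  -- the local Prop. 2 at the top of the chain
  have hN := plaqSmallOn_iter_blockAvg_eml_loc_level (n := Fin 2) (P := F.P K) s hα₀pos hα3 hα2 xs hxs r hrstep h52 (j := s) le_rfl
  have hqbox : q ∈ boxRegion (xs s) (r s) := by
    rw [hxs_top, mem_boxRegion]
    intro ν
    exact ⟨0, by rw [hr]; simp, by simp⟩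
  have hlt := hN q (Finset.mem_coe.mpr hqbox)
  -- arithmetic: `2α₀·(Lˢ·(Lˢ)⁻¹)² = (2L²a)·L^{−2(i−s)} ≤ C68·θBal(K−i)·L^{−2(i−s)}`
  have hone : ((F.P K).L : ℝ) ^ s * (((F.P K).L : ℝ) ^ s)⁻¹ = 1 := by
    rw [hPL]; exact mul_inv_cancel₀ hLs.ne'
  rw [hone, one_pow, mul_one] at hlt
  refine hlt.le.trans ?_
  have hw := hwin i hi1 hik
  have hx0 : (0 : ℝ) ≤ (((F.L : ℝ) ^ (i - s))⁻¹) ^ 2 := by positivity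
  have hfac : ((F.L : ℝ) ^ s * ((F.L : ℝ) ^ (i - 1))⁻¹) ^ 2 = (F.L : ℝ) ^ 2 * (((F.L : ℝ) ^ (i - s))⁻¹) ^ 2 := by
    have hLis : (0 : ℝ) < (F.L : ℝ) ^ (i - s) := by positivity
    have hbase : (F.L : ℝ) ^ s * ((F.L : ℝ) ^ (i - 1))⁻¹ = (F.L : ℝ) * ((F.L : ℝ) ^ (i - s))⁻¹ := by
      rw [← div_eq_mul_inv, ← div_eq_mul_inv, div_eq_div_iff hLi1.ne' hLis.ne', ← pow_add, ← pow_succ']; congr 1; omega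
    rw [hbase, mul_pow]
  calc 2 * α₀ = 2 * ((F.L : ℝ) ^ 2 * a) * (((F.L : ℝ) ^ (i - s))⁻¹) ^ 2 := by rw [hα₀, hfac]; ring
    _ ≤ 𝔠.C68 * θBal F.L γ 𝔠.b₀ 𝔠.p₀ (K - i) * (((F.L : ℝ) ^ (i - s))⁻¹) ^ 2 := mul_le_mul_of_nonneg_right hw hx0

/-! ## §3 Nested fine regularity ⇒ small (0.4)-loops on the constraint's read cone -/

/-- ★★ **(n1) CORE MEMBERSHIP FROM NESTED REGULARITY**: a fine configuration `U` with NESTED fine regularity `α_i·L^{−2i}` on the regions `Ω_i(h)` of a history `h` (`i ≤ k ≤ K`; the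
display ✓ `NestedRegularSelT3R7`'s clause (2)), Prop. 2's smallness one factor `L²` up, the record size `7L + 3 ≤ M₁` and the windows `2L²·α_{i−1} ≤ C68·θBal(K−i)` (`1 ≤ i ≤ k`) —
the SAME rows as ✓ `mem_reg68LevelsSet_of_plaqSmallOn_Omega`, minus `hwin0` — lies in the LOCAL SMALL-LOOP CORE `NestedSmallOn ℰp (δ∕2) (constraintCone k h) k` of
✓ `…Data7Closed.isClosed_coneFibreRegLe` ∕ `continuousOn_datumE_cone` (the cone written inline, same bytes): at every level-`(s+1)` cone bond the (0.4) loop variables of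
`(ℰp-avg)ˢ U` are within `δ∕2` of `1`.  Two-block reduction ✓ `BoxStokes.dist1_loopHol_le_twoBlock` + §2 at the cone's witness `(i, c)` (the base point of a two-block plaquette of
`c′` has its `i`-block among `{c₋, c₊}`, one of which lies in `Λ_i(h) ⊆ Ω_i(h)`) + ✓ `loopWindow_T3`.
[cite: Balaban1985UV3, (39)–(42) p.266, p.267 l.1–3, (68) p.273; Balaban1985Averaging, (19)–(20) p.21, Prop. 2 (54) p.26; Balaban1987RG1, (0.4) p.253] -/
theorem AlphaInputsT3AC.mem_nestedSmallOn_constraintCone_of_plaqSmallOn_Omega {k : ℕ} (hk : k ≤ K) (h : Hist (F.P K) k)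
    {U : GaugeField (F.P K) 0 (Matrix.specialUnitaryGroup (Fin 2) ℂ)} {α : ℕ → ℝ} (hα : ∀ i, i ≤ k → 0 < α i)
    (hU : ∀ i, i ≤ k → PlaqSmallOn (↑(plaqsIn 0 (Omega 𝔠.lane.carrier.M₁
        (rcolOf (T3Scales F γ hγ (hγ1.trans (sq_min_one_le _ 𝔠.gamma0_pos)) K) 𝔠.lane.carrier) k h i)) : Set (Plaq (F.P K) 0))
        (α i * (((F.L : ℝ) ^ i)⁻¹) ^ 2) U)
    (hsmall : ∀ i, i ≤ k → (143 * ((7 : ℝ) ^ 2 / 4) ^ 2) * ((F.L : ℝ) ^ 2 * α i) ≤ 1 / 3 ∧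
        2 * ((F.L : ℝ) ^ 2 * α i) ≤ 2 * deltaSU (Fin 2) / ((7 * F.L : ℕ) : ℝ) ^ 2)
    (hM₁ : 7 * F.L + 3 ≤ 𝔠.M₁)
    (hwin : ∀ i, 1 ≤ i → i ≤ k → 2 * ((F.L : ℝ) ^ 2 * α (i - 1)) ≤ 𝔠.C68 * θBal F.L γ 𝔠.b₀ 𝔠.p₀ (K - i)) :
    U ∈ NestedSmallOn ℰp (ℰp.δ / 2) (fun s => {b : PBond (F.P K) s | ∃ i, s ≤ i ∧ i ≤ k ∧ ∃ c : PBond (F.P K) i,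
        c ∈ bondsOn i (lam42 (Omega 𝔠.lane.carrier.M₁ (rcolOf (T3Scales F γ hγ (hγ1.trans (sq_min_one_le _ 𝔠.gamma0_pos)) K) 𝔠.lane.carrier) k h) k i) ∧
        (coarsen i (toFine s b.src) = c.src ∨ coarsen i (toFine s b.src) = c.tgt) ∧
        (coarsen i (toFine s b.tgt) = c.src ∨ coarsen i (toFine s b.tgt) = c.tgt)}) k := by
  intro s hs c' hc' x
  obtain ⟨i, hsi, hik, c, hc, hsrc', htgt'⟩ := hc'
  set S := T3Scales F γ hγ (hγ1.trans (sq_min_one_le _ 𝔠.gamma0_pos)) K with hS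
  set Ω : ℕ → Set (Site (F.P K) 0) := Omega 𝔠.lane.carrier.M₁ (rcolOf S 𝔠.lane.carrier) k h with hΩ
  have hs1 : s + 1 ≤ (F.P K).m + (F.P K).K := (hsi.trans hik).trans (AlphaInputsT3AC.le_standing_of_le hk)
  have hs0 : s ≤ (F.P K).m + (F.P K).K := (Nat.le_succ s).trans hs1
  have hiK : i ≤ (F.P K).m + (F.P K).K := hik.trans (AlphaInputsT3AC.le_standing_of_le hk)
  have hL1 : (1 : ℝ) ≤ F.L := by exact_mod_cast le_of_lt F.hL.2
  have hL0 : (0 : ℝ) < F.L := by linarith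
  have hγone : γ ≤ 1 := hγ1.trans (sq_min_one_le _ 𝔠.gamma0_pos)
  -- the end-point of `c` on `Λ_i(h)`
  obtain ⟨w, hwΛ, hw⟩ : ∃ w : Site (F.P K) i, toFine i w ∈ lam42 Ω k i ∧ (w = c.src ∨ w = c.tgt) := by
    rcases hc with hc | hc
    · exact ⟨c.src, hc, Or.inl rfl⟩
    · exact ⟨c.tgt, hc, Or.inr rfl⟩
  have hyΩ : toFine i w ∈ Ω i := lam42_subset_Omega Ω k i hik hwΛ
  set θ : ℝ := 𝔠.C68 * θBal F.L γ 𝔠.b₀ 𝔠.p₀ (K - i) with hθ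
  have hθ0 : 0 ≤ θ :=
    mul_nonneg 𝔠.C68_pos.le (θBal_pos (by exact_mod_cast le_of_lt F.hL.2) hγ hγone 𝔠.b₀_pos 𝔠.p₀ (K - i)).le
  set δs : ℝ := θ * (((F.L : ℝ) ^ (i - s))⁻¹) ^ 2 with hδs
  have hδs0 : 0 ≤ δs := by positivity
  -- the two-block plaquettes of `c′` are one block off `Ω_i(h)`: §2
  have hplaq : ∀ q : Plaq (F.P K) s, (blockOf q.src = c'.src ∨ blockOf q.src = c'.tgt) →
      (blockOf ((q.src.shift q.μ).shift q.ν) = c'.src ∨ blockOf ((q.src.shift q.μ).shift q.ν) = c'.tgt) →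
      GaugeGroup.dist1 (GaugeField.plaqHol (Averaging.iter (fun l => (BlockAveraging.blockAvg ℰp : Averaging (F.P K) l _)) s U) q) ≤ δs := by
    intro q hLL _
    -- the `i`-block of the base point `toFine s q₋` is an end-point of `c`
    have key : ∀ z : Site (F.P K) (s + 1), blockOf q.src = z → coarsen i (toFine s q.src) = coarsen i (toFine (s + 1) z) := fun z hzy =>
      coarsen_eq_of_coarsen_eq (j' := s + 1) (by rw [coarsen_succ, coarsen_toFine s hs0, hzy, coarsen_toFine (s + 1) hs1]) hsi
    have hblk : coarsen i (toFine s q.src) = c.src ∨ coarsen i (toFine s q.src) = c.tgt := by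
      rcases hLL with hz | hz
      · rw [key _ hz]; exact hsrc'
      · rw [key _ hz]; exact htgt'
    -- hence at scale-`i` distance `≤ 1` from `toFine i w`
    have hnear : sdist i (toFine s q.src) (toFine i w) ≤ 1 := by
      show Site.tdist (coarsen i (toFine s q.src)) (coarsen i (toFine i w)) ≤ 1
      rw [coarsen_toFine i hiK]
      rcases hblk with hb | hb <;> rcases hw with hw | hw <;> rw [hb, hw]
      · rw [tdist_self]; exact Nat.zero_le _
      · exact tdist_shift_le c.src c.dir
      · rw [tdist_comm]; exact tdist_shift_le c.src c.dir
      · rw [tdist_self]; exact Nat.zero_le _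
    exact AlphaInputsT3AC.dist1_plaqHol_iter_le_near_Omega (𝔠 := 𝔠) (hγ := hγ) (hγ1 := hγ1) hk h hα hU hsmall hM₁ hwin hsi hik q hyΩ hnear
  refine (BoxStokes.dist1_loopHol_le_twoBlock hs1 hδs0 c' hplaq x).trans ?_
  -- `((d+2)L)²/4 · θ·L^{−2(i−s)} ≤ (25/4)·θ ≤ δ∕2` since `i − s ≥ 1`
  have hd : ((F.P K).d + 2) * (F.P K).L = (3 + 2) * F.L := rfl
  rw [hd]
  have hcast : ((((3 + 2) * F.L : ℕ) : ℝ)) = 5 * (F.L : ℝ) := by push_cast; ring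
  rw [hcast]
  have hratio : (F.L : ℝ) * ((F.L : ℝ) ^ (i - s))⁻¹ ≤ 1 := by
    rw [mul_inv_le_iff₀ (pow_pos hL0 _), one_mul]
    calc (F.L : ℝ) = (F.L : ℝ) ^ 1 := (pow_one _).symm
      _ ≤ (F.L : ℝ) ^ (i - s) := pow_le_pow_right₀ hL1 (by omega)
  have hratio0 : 0 ≤ (F.L : ℝ) * ((F.L : ℝ) ^ (i - s))⁻¹ := by positivity
  calc (5 * (F.L : ℝ)) ^ 2 / 4 * δs = (25 / 4 : ℝ) * θ * ((F.L : ℝ) * ((F.L : ℝ) ^ (i - s))⁻¹) ^ 2 := by rw [hδs]; ring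
    _ ≤ (25 / 4 : ℝ) * θ * 1 := by
        refine mul_le_mul_of_nonneg_left ?_ (by positivity)
        nlinarith
    _ = (25 / 4 : ℝ) * (𝔠.C68 * θBal F.L γ 𝔠.b₀ 𝔠.p₀ (K - i)) := by rw [hθ]; ring
    _ ≤ ℰp.δ / 2 := AlphaInputsT3AC.loopWindow_T3 (F := F) (𝔠 := 𝔠) (γ := γ) (hγ := hγ) (hγ1 := hγ1) (K := K) (hik.trans hk)

end T3

end Summit.QuantumFields.YangMills.Theorems

end
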